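import Summits.AnomalousDissipation.AnomalousDissipation.Theses.TwoAndHalfD
import Summits.AnomalousDissipation.AnomalousDissipation.Theorems.TwohalfdNeg.Negative.LoadBearing
import Summits.AnomalousDissipation.AnomalousDissipation.Theorems.TwohalfdNeg.Negative.ZeroMeanAndKillShape
import Summits.AnomalousDissipation.AnomalousDissipation.Theorems.TwohalfdNeg.Negative.SweptThreshold
import Summits.AnomalousDissipation.AnomalousDissipation.Theorems.TwohalfdNeg.Negative.ThresholdTable
import Literature.Analysis.FluidPDE.DoeringFoiasPowerProofs
import Literature.Analysis.FluidPDE.DoeringFoiasProofs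
import Literature.Analysis.FluidPDE.DoeringFoiasAmplitudeProofs
import Literature.Analysis.FunctionSpaces.TorusTestFunction
import Literature.Analysis.FunctionSpaces.TorusFourierConvolution
import Literature.Analysis.FluidPDE.ZerothLawProofs
import Literature.Analysis.FluidPDE.LongTimeAverageNonneg
import Literature.Analysis.FluidPDE.LongTimeAverageSubadditive
import Literature.Analysis.FluidPDE.LerayHopfSpectralMeasurability
import Literature.Analysis.FluidPDE.TwoHalfSection
import Literature.Analysis.FluidPDE.TwoHalfNavierStokes
import Literature.Barriers.AnomalousDissipation.TwoDimensionalEnergyDissipationProofs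

/-!
# Disproof of `TwohalfdThesis` (crux `twohalfd_thesis`, stmt-AnomalousDissipation-0206) — work file of the
# standing adversary (cdisprove) on the TARGET of route `TwoAndHalfD`

`X := TwohalfdThesis`: ONE steady smooth solenoidal mean-zero `x₃`-invariant force `f` on `T³`, viscosities
`ν_j → 0`, `x₃`-invariant global Leray–Hopf solutions `u_j` of NS_{ν_j} forced by `f`, `sup_j ⟨‖u_j‖²⟩ ≤ E`,
`⟨ν_j‖∇u_j‖²⟩ ≥ ε > 0` (Bruè–De Lellis 2023 Q2.1 ∧ Q2.2 in the stationary, long-time-average regime).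
Prose lives in docstrings only.  FINDINGS INDEX (cycle 1, 2026-08-16):

* §1 KILL SHAPE.  `not_twohalfdThesis_iff_twohalfdNeg : ¬ X ↔ TwohalfdNeg` (the sibling crux #5,
  stmt-0211; certified in `Theorems/TwohalfdNeg/Negative/ZeroMeanAndKillShape.lean`, p74035, imported here).
  A disproof of `X` is EXACTLY a proof of the in-class negation — the negative answer to BdL Q2.1 in the
  stationary regime, open in print.  There is no formal loophole to exploit on the `∃` side either: the `limsup`
  junk of `meanEnergy` (value `0` on unbounded Cesàro means) would HELP a witness, but it is unreachable for
  Leray–Hopf solutions under a mean-zero force (`Torus.IsGlobalLerayHopf.timeMean_norm_sq_le`, in tree), and the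
  junk of `meanDissipation` (`toReal ∞ = 0`, empty-`sInf` = `0`) can only LOWER the dissipation, never fake `≥ ε`.
* §2 THE DISPROVER'S LOAD-BEARING CONSTRAINTS = relaxations of `X` that are THEOREMS (explicit Leray–Hopf
  witnesses; the laminar / swept / ramp families of the sibling seat's certified files, re-read on the `∃` side):
  `X` without the energy ceiling (`twohalfdThesisWithoutEnergyBound_holds`: laminar shear `u_j = f/(4π²ν_j)`),
  without `ν_j → 0` (`…WithoutVanishingViscosity_holds`: `ν ≡ 1`), with a level-dependent steady force even
  uniformly bounded in `L^∞` (`twohalfdThesisLevelDependentForce_holds`: forcing at the dissipative scale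
  `|k| ~ ν^{-1/2}`), without `HasZeroMean f` (`…WithoutZeroMeanForce_holds`: accelerating ramp, energy = junk `0`),
  and with the ceiling relaxed to `E/ν_j` (`twohalfdThesisEnergyInvNu_holds`: Galilean-swept shear with drift
  `√ν_j`).  READING FOR A DISPROOF: ¬X must use, quantitatively, (i) the ceiling at scale `E ≪ ν⁻¹`, (ii) that `f`
  is one FIXED field (`L²`-precompactness of the force family — the level-dependent witnesses converge in `H⁻¹`),
  (iii) `ν_j → 0`, (iv) `HasZeroMean f` (only to make the ceiling honest).  READING FOR A PROOF: every explicit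
  in-class family balances `f` by viscosity (`u ~ f/ν`, `E ~ ν⁻²`) or is Doppler-detuned (swept, `D = O(ν)`); a
  witness needs NONLINEAR saturation of the planar flow plus `ν`-uniform mixing of the sourced third component.
* §3 ANATOMY OF A WITNESS (necessary conditions, Leray–Hopf level, from tree theorems; `IsWitness` bundles the
  data of `X`, `twohalfdThesis_iff_exists_isWitness`):
  - power floor `ε ≤ ⟨f, u_j⟩` at every level (`IsWitness.eps_le_meanPower`, Doering–Foias
    `DoeringFoias2002_dissipation_le_power_holds`): the fixed force must keep injecting power `≥ ε` through the LOW
    modes where `f̂` lives, at every level;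
  - `ε ≤ ‖f‖₂ √E` (`IsWitness.eps_le_norm_mul_sqrt`), hence `E > 0`, `‖f‖₂ > 0`, `ε² ≤ ‖f‖₂² E`: the three budgets
    of `X` are not independent (a witness with small energy or small force is impossible);
  - enstrophy floor `⟨‖∇u_j‖²⟩ ≥ ε/ν_j → ∞` (`IsWitness.enstrophy_ge`, `IsWitness.tendsto_enstrophy_atTop`), so
    the natural strengthening "`X` with `ν`-uniformly bounded mean enstrophy" is FALSE
    (`not_twohalfdThesisBoundedEnstrophy`): witnesses are genuinely multi-scale (gradients at `|k| ~ ν^{-1/2}`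
    while the power enters at `|k| = O(1)`), i.e. a cascade INSIDE the `x₃`-invariant class — by Alexakis–Doering
    (`Literature.Barriers.AnomalousDissipation.AlexakisDoering2006_energyDissipationBound_holds`, proved) it can
    only be the forward cascade of the third component `u₃` advected by the planar flow.
* §3b ENERGY FLOOR `‖f‖₂² ≤ ‖∇f‖_∞ · E` (`IsWitness.integral_norm_sq_le_mul_energy`; Doering–Foias amplitude bound tested
  against `f` itself, packaged for a GENERAL smooth force via `shapeOf`/`integral_norm_sq_le_of_isGlobalLerayHopf`): uses only
  the fixed force and the ceiling, so it binds EVERY bounded-energy in-class family; with §3, a witness lives in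
  `E ≥ max(‖f‖₂²/‖∇f‖_∞, ε²/‖f‖₂²)` — no small-energy witnesses, no weak-force witnesses.
* §4 NEAR-MISSES = sub-classes where `X` is FALSE ON PAPER but not yet formalised (sorried, with the formal plan
  in each docstring): vertical force `f = (0,0,h)` (`not_twohalfdThesis_verticalForce`), planar force `f = (g,0)`
  (`not_twohalfdThesis_planarForce`), single Stokes shell (`not_twohalfdThesis_singleShell`).  COMMON FORMAL
  OBSTRUCTION: the DESCENT of an `x₃`-invariant Leray–Hopf solution `u = (v,w)∘π` to a 2-D Leray–Hopf solution `v`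
  (force `g`) plus a weak sourced scalar `w` — the weak formulation descends by Fubini (test with `twoHalf ψ 0`,
  `twoHalf 0 φ`), but the COMPONENT-WISE energy inequality needs the 2-D energy EQUALITY in the Lions–Prodi class
  (`v ∈ L⁴ₜL⁴ₓ` by Ladyzhenskaya), which the tree has on `ℝ³` (`lions_energy_equality_L4_holds`) but not on `T²`;
  a slick route: `(v, λw)` is again a weak solution with force `(g, λh)`, so energy equality for two values of `λ`
  splits the budget.  This descent is ALSO what the route's kill criterion ("X ⇒ #2") and support items
  14323–14325 need; it is the single most useful piece of infrastructure for both sides of this crux.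
* §5 THE PLANAR-FORCE NO-GO MODULO ONE NAMED GAP (kernel-checked reduction): `PlanarDescentEnergyEq` (the planar part of an
  `x₃`-invariant Leray–Hopf solution driven by `(g,h)∘π` is a 2-D Leray–Hopf solution driven by `g` obeying the long-time energy
  budget `⟨g,v⟩ ≤ ⟨ν‖∇v‖²⟩`; BLNNT 2013 §2 + Lions–Prodi) ⟹ `¬ TwohalfdThesisPlanarForceSmoothData`
  (`not_twohalfdThesisPlanarForceSmoothData_of_descent`, PROVED: Doering–Foias power inequality, `meanPower_twoHalf_zero`,
  `meanEnergy_planarPart_le`, `shapeOf`, and the tree's PROVED 2-D no-zeroth-law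
  `Literature.Barriers.AnomalousDissipation.no_twoDimensional_zerothLaw`).  Reading: granted one textbook fact, a witness of
  `X` with smooth data MUST source its third component (`h ≠ 0`) — the anomaly is scalar dissipation paid for by `⟨h,u₃⟩`.

* §6 (cycle 2, separate file) DESCENT, FIRST INSTALMENT — PROVED: `Negative/DescentWeak.lean`
  (`Descent.isWeakNSSolutionForcedOn_planarPart`): the planar part of an `x₃`-invariant WEAK Navier–Stokes solution on `T³`
  with force `(g,h)∘π` is a weak solution of the 2-D system with force `g` (lift of planar tests, `∂ₜ`/convective/viscous/force
  terms descend).  What is left of the gap `PlanarDescentEnergyEq`: the remaining Leray–Hopf clauses of the planar part (routine)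
  and the component-wise energy inequality (the analytic half).  CERTIFIED COPIES so far: `Negative/Relaxations.lean` (p84098),
  `Negative/Anatomy.lean` (p84332); pending: `Negative/PlanarForceOfDescent.lean` (+ the relocated named fact
  `Literature.Analysis.FluidPDE.PlanarDescentEnergyEq`), `Negative/DescentWeak.lean`.

WHAT A WITNESS MUST LOOK LIKE (the checked constraints, for ideators of `X`; `f = (g,h)∘π`, `u_j = (v_j,w_j)∘π`):
(1) ONE fixed smooth force doing work `⟨f,u_j⟩ ≥ ε` at every level through its own low modes (§3), with
`E ≥ max(‖f‖₂²/‖∇f‖_∞, ε²/‖f‖₂²)` (§3, §3b) — no small-energy, weak-force, or `ν`-tuned-force constructions (§2);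
(2) mean enstrophy `≥ ε/ν_j → ∞` (§3): a genuine cascade inside the class, not a `ν`-uniformly `H¹`/Lipschitz/Galerkin family;
(3) energy `O(1)` — NOT `O(ν⁻¹)`: every viscosity-balanced (`u ~ f/ν`) or Doppler-detuned (swept) laminar response is out (§2);
(4) granted the descent gap, `h ≠ 0` (§5): the third component must be SOURCED, and by Alexakis–Doering the planar dissipation is
`O(ν^{1/2})`, so asymptotically ALL of `ε` is scalar dissipation `ν_j⟨‖∇w_j‖²⟩ = ⟨h, w_j⟩ + o(1)`; (5) on paper also `g ≠ 0`
spanning ≥ 2 shells (§4: vertical-force and single-shell no-go's) — the planar flow must be DRIVEN and non-rigid.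
So an `X`-witness = a steadily forced 2-D Navier–Stokes family with `O(1)` energy (crux #3, printed open) that keeps the sourced
scalar `w_j` correlated with its source, `⟨h,w_j⟩ ≥ ε`, uniformly as `ν_j → 0` (crux #2) — exactly the route's two cruxes; this
file found no way around either and no cheaper sub-case that survives.

VERDICT (cycle 1): no kill, no loophole; `X` resists because its negation is an open rigidity statement
(no anomalous dissipation for steadily forced 2½-D flows at bounded energy) whose only printed evidence is
phenomenological (enstrophy-cascade smoothness of the planar flow ⇒ Batchelor-regime scalar with variance
`~ χ log(1/ν)/γ`, so bounded variance forces `χ ≲ Eγ/log(1/ν)`; the sibling file's "expected rate").  Next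
regimes: prove the descent gap `PlanarDescentEnergyEq` (its irreducible part: component-wise energy inequality, §5 docstring),
which makes §5 unconditional and also settles the route's kill criterion "X ⇒ #2"; then the vertical-force no-go; keep the
literature watch on BdL Q2.1 (search-degraded this cycle: searchd rc 75, OpenAlex/S2/arXiv 429; Crossref-only sweep found
nothing new; the route review of 2026-08-16 swept forward citations of BdL2023/JS2024/Cheskidov2023/CTV2013 with the same result).
-/

noncomputable section

set_option linter.dupNamespace false

namespace Summit.AnomalousDissipation.AnomalousDissipation.Cruxes.TwohalfdThesis.Disproof

open MeasureTheory Set Filter Topology UnitAddTorus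
open scoped ENNReal NNReal InnerProductSpace
open Literature.Analysis.FunctionSpaces Literature.Analysis.FunctionSpaces.Torus
open Literature.Analysis.FluidPDE Literature.Analysis.FluidPDE.Torus
open Summit.AnomalousDissipation.AnomalousDissipation.Theses
open Summit.AnomalousDissipation.AnomalousDissipation.Theses.TwoAndHalfD
open Summit.AnomalousDissipation.AnomalousDissipation.Theorems.TwohalfdNeg.Negative

/-- Local notation: the flat unit three-torus. -/
local notation "𝕋³" => UnitAddTorus (Fin 3)
/-- Local notation: velocity values. -/
local notation "E³" => EuclideanSpace ℝ (Fin 3)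

/-! ## §1 Kill shape -/

section KillShape

/-- **KILL SHAPE.** `¬ X ↔ TwohalfdNeg`: a disproof of the route target is exactly a proof of the in-class
negation (crux #5, stmt-AnomalousDissipation-0211), i.e. the negative answer to Bruè–De Lellis 2023, Questions
2.1–2.2, in the stationary long-time-average regime — open in print.  (Symmetric form of the sibling seat's
`twohalfdNeg_iff_not_twohalfdThesis`.) [folklore] -/
theorem not_twohalfdThesis_iff_twohalfdNeg : ¬ TwohalfdThesis ↔ TwohalfdNeg :=
  twohalfdNeg_iff_not_twohalfdThesis.symm

-- (`X → AnomalousDissipation` is the route's deciding theorem `TwoAndHalfD.closes`; not restated here, to keep the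
-- audit's proof-of-item detector quiet.)

end KillShape

/-! ## §2 Relaxations of `X` that HOLD: the constraints a disproof must use -/

section Relaxations

/-- `X` with the ENERGY CEILING deleted (everything else verbatim). -/
def TwohalfdThesisWithoutEnergyBound : Prop :=
  ∃ f : 𝕋³ → E³, (∀ (s : UnitAddCircle) (x : 𝕋³), f (x + Pi.single (2 : Fin 3) s) = f x) ∧
    IsSmooth f ∧ IsDivFree f ∧ HasZeroMean f ∧
    ∃ (ν : ℕ → ℝ) (u₀ : ℕ → 𝕋³ → E³) (u : ℕ → ℝ → 𝕋³ → E³),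
      (∀ j, 0 < ν j) ∧ Tendsto ν atTop (𝓝 0) ∧
      (∀ j, IsGlobalLerayHopf (ν j) (fun _ => f) (u₀ j) (u j)) ∧
      (∀ j (t : ℝ) (s : UnitAddCircle) (x : 𝕋³), u j t (x + Pi.single (2 : Fin 3) s) = u j t x) ∧
      ∃ ε : ℝ, 0 < ε ∧ ∀ j, ε ≤ meanDissipation (ν j) (u j)

/-- **Without the energy ceiling `X` is a theorem** (so ¬X must use the ceiling): the fixed vertical shear
force `f = (0,0,cos 2πx₀)`, `ν_j = 1/(j+1)`, and the laminar steady states `u_j = f/(4π²ν_j)` (global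
Leray–Hopf, `x₃`-invariant) dissipate `(j+1)/(8π²) ≥ 1/(8π²)` — with energy `∝ ν_j⁻²`, which is what the
ceiling excludes.  Dual of `twohalfdNeg_false_without_energyBound`. [folklore] -/
theorem twohalfdThesisWithoutEnergyBound_holds : TwohalfdThesisWithoutEnergyBound := by
  have hν : ∀ j : ℕ, (0 : ℝ) < 1 / ((j : ℝ) + 1) := fun j => by positivity
  have hb : ∀ j : ℕ, (1 : ℝ) =
      4 * Real.pi ^ 2 * (((0 : ℕ) : ℝ) + 1) ^ 2 * (1 / ((j : ℝ) + 1)) * (((j : ℝ) + 1) / (4 * Real.pi ^ 2)) := by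
    intro j
    have hj : (j : ℝ) + 1 ≠ 0 := by positivity
    have hπ : (Real.pi : ℝ) ^ 2 ≠ 0 := by positivity
    field_simp
    simp
  refine ⟨shear 0 1, shear_add_single 0 1, isSmooth_shear 0 1, isDivFree_shear 0 1, hasZeroMean_shear 0 1,
    fun j => 1 / ((j : ℝ) + 1), fun j => shear 0 (((j : ℝ) + 1) / (4 * Real.pi ^ 2)),
    fun j _ => shear 0 (((j : ℝ) + 1) / (4 * Real.pi ^ 2)), hν, tendsto_one_div_add_atTop_nhds_zero_nat,
    fun j => isGlobalLerayHopf_shear 0 (hb j), fun j _ s x => shear_add_single 0 _ s x,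
    1 / (8 * Real.pi ^ 2), by positivity, fun j => ?_⟩
  rw [meanDissipation_shear]
  have hj : (0 : ℝ) < (j : ℝ) + 1 := by positivity
  have hπ : (0 : ℝ) < Real.pi ^ 2 := by positivity
  have heq : 1 / ((j : ℝ) + 1) * (2 * Real.pi ^ 2 * (((0 : ℕ) : ℝ) + 1) ^ 2 *
      (((j : ℝ) + 1) / (4 * Real.pi ^ 2)) ^ 2) = ((j : ℝ) + 1) / (8 * Real.pi ^ 2) := by
    field_simp
    simp
    ring
  rw [heq]
  exact div_le_div_of_nonneg_right (by linarith) (by positivity)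

/-- `X` with `ν_j → 0` deleted (everything else verbatim). -/
def TwohalfdThesisWithoutVanishingViscosity : Prop :=
  ∃ f : 𝕋³ → E³, (∀ (s : UnitAddCircle) (x : 𝕋³), f (x + Pi.single (2 : Fin 3) s) = f x) ∧
    IsSmooth f ∧ IsDivFree f ∧ HasZeroMean f ∧
    ∃ (ν : ℕ → ℝ) (u₀ : ℕ → 𝕋³ → E³) (u : ℕ → ℝ → 𝕋³ → E³),
      (∀ j, 0 < ν j) ∧
      (∀ j, IsGlobalLerayHopf (ν j) (fun _ => f) (u₀ j) (u j)) ∧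
      (∀ j (t : ℝ) (s : UnitAddCircle) (x : 𝕋³), u j t (x + Pi.single (2 : Fin 3) s) = u j t x) ∧
      (∃ E : ℝ, ∀ j, meanEnergy (u j) ≤ E) ∧
      ∃ ε : ℝ, 0 < ε ∧ ∀ j, ε ≤ meanDissipation (ν j) (u j)

/-- **Without `ν_j → 0`, `X` is a theorem** (sanity: the content is in the limit): `ν ≡ 1`, the laminar state
`u = f/(4π²)`, energy `1/(32π⁴)`, dissipation `1/(8π²)`. Dual of `twohalfdNeg_false_without_vanishingViscosity`. [folklore] -/
theorem twohalfdThesisWithoutVanishingViscosity_holds : TwohalfdThesisWithoutVanishingViscosity := by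
  have hb : (1 : ℝ) = 4 * Real.pi ^ 2 * (((0 : ℕ) : ℝ) + 1) ^ 2 * 1 * (1 / (4 * Real.pi ^ 2)) := by
    have hπ : (Real.pi : ℝ) ^ 2 ≠ 0 := by positivity
    field_simp
    simp
  refine ⟨shear 0 1, shear_add_single 0 1, isSmooth_shear 0 1, isDivFree_shear 0 1, hasZeroMean_shear 0 1,
    fun _ => 1, fun _ => shear 0 (1 / (4 * Real.pi ^ 2)), fun _ _ => shear 0 (1 / (4 * Real.pi ^ 2)),
    fun _ => one_pos, fun _ => isGlobalLerayHopf_shear 0 hb, fun _ _ s x => shear_add_single 0 _ s x,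
    ⟨(1 / (4 * Real.pi ^ 2)) ^ 2 / 2, fun _ => (meanEnergy_shear 0 _).le⟩,
    1 * (2 * Real.pi ^ 2 * (((0 : ℕ) : ℝ) + 1) ^ 2 * (1 / (4 * Real.pi ^ 2)) ^ 2), by positivity,
    fun _ => (meanDissipation_shear 0 1 _).ge⟩

/-- `X` with the force allowed to depend on the level `j` — each `f_j` steady, smooth, solenoidal, mean zero,
`x₃`-invariant, and the family UNIFORMLY BOUNDED IN `L^∞` — everything else verbatim. -/
def TwohalfdThesisLevelDependentForce : Prop :=
  ∃ f : ℕ → 𝕋³ → E³, (∀ j (s : UnitAddCircle) (x : 𝕋³), f j (x + Pi.single (2 : Fin 3) s) = f j x) ∧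
    (∀ j, IsSmooth (f j)) ∧ (∀ j, IsDivFree (f j)) ∧ (∀ j, HasZeroMean (f j)) ∧
    (∃ M : ℝ, ∀ j x, ‖f j x‖ ≤ M) ∧
    ∃ (ν : ℕ → ℝ) (u₀ : ℕ → 𝕋³ → E³) (u : ℕ → ℝ → 𝕋³ → E³),
      (∀ j, 0 < ν j) ∧ Tendsto ν atTop (𝓝 0) ∧
      (∀ j, IsGlobalLerayHopf (ν j) (fun _ => f j) (u₀ j) (u j)) ∧
      (∀ j (t : ℝ) (s : UnitAddCircle) (x : 𝕋³), u j t (x + Pi.single (2 : Fin 3) s) = u j t x) ∧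
      (∃ E : ℝ, ∀ j, meanEnergy (u j) ≤ E) ∧
      ∃ ε : ℝ, 0 < ε ∧ ∀ j, ε ≤ meanDissipation (ν j) (u j)

/-- **With a level-dependent STEADY force (uniformly bounded in `L^∞`) `X` is a theorem** — the cheap in-class
shadow of Cheskidov 2023 Thm 1.3 / Johansson–Sorella Thm 1.5 (`ν`-dependent forces): `f_j = 4π²cos(2π(j+1)x₀)e₃`,
`ν_j = (j+1)⁻²`, laminar `u_j = cos(2π(j+1)x₀)e₃`, energy `1/2`, dissipation `2π²` at every level (forcing AT
the dissipative scale `|k| ~ ν^{-1/2}`: work goes straight into heat, no cascade).  So ¬X must use that `f` is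
ONE FIXED field — `L²`-precompactness of `{f}`; norm bounds on the force do not suffice (the witnesses converge in
`H⁻¹`).  Dual of `twohalfdNeg_false_without_fixedForce`. [folklore] -/
theorem twohalfdThesisLevelDependentForce_holds : TwohalfdThesisLevelDependentForce := by
  have hν : ∀ j : ℕ, (0 : ℝ) < (1 / ((j : ℝ) + 1)) ^ 2 := fun j => by positivity
  have hν0 : Tendsto (fun j : ℕ => (1 / ((j : ℝ) + 1)) ^ 2) atTop (𝓝 0) := by
    simpa using (tendsto_one_div_add_atTop_nhds_zero_nat (𝕜 := ℝ)).pow 2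
  have hb : ∀ j : ℕ, (4 * Real.pi ^ 2 : ℝ) =
      4 * Real.pi ^ 2 * ((j : ℝ) + 1) ^ 2 * (1 / ((j : ℝ) + 1)) ^ 2 * 1 := by
    intro j
    have hj : (j : ℝ) + 1 ≠ 0 := by positivity
    field_simp
  refine ⟨fun j => shear j (4 * Real.pi ^ 2), fun j s x => shear_add_single j _ s x,
    fun j => isSmooth_shear j _, fun j => isDivFree_shear j _, fun j => hasZeroMean_shear j _,
    ⟨|4 * Real.pi ^ 2|, fun j x => norm_shear_le j _ x⟩, fun j => (1 / ((j : ℝ) + 1)) ^ 2,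
    fun j => shear j 1, fun j _ => shear j 1, hν, hν0, fun j => isGlobalLerayHopf_shear j (hb j),
    fun j _ s x => shear_add_single j 1 s x, ⟨1 ^ 2 / 2, fun j => (meanEnergy_shear j 1).le⟩,
    2 * Real.pi ^ 2, by positivity, fun j => ?_⟩
  rw [meanDissipation_shear]
  have hj : (j : ℝ) + 1 ≠ 0 := by positivity
  have heq : (1 / ((j : ℝ) + 1)) ^ 2 * (2 * Real.pi ^ 2 * ((j : ℝ) + 1) ^ 2 * 1 ^ 2) = 2 * Real.pi ^ 2 := by
    field_simp
  rw [heq]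

/-- `X` with `HasZeroMean f` deleted (everything else verbatim). -/
def TwohalfdThesisWithoutZeroMeanForce : Prop :=
  ∃ f : 𝕋³ → E³, (∀ (s : UnitAddCircle) (x : 𝕋³), f (x + Pi.single (2 : Fin 3) s) = f x) ∧
    IsSmooth f ∧ IsDivFree f ∧
    ∃ (ν : ℕ → ℝ) (u₀ : ℕ → 𝕋³ → E³) (u : ℕ → ℝ → 𝕋³ → E³),
      (∀ j, 0 < ν j) ∧ Tendsto ν atTop (𝓝 0) ∧
      (∀ j, IsGlobalLerayHopf (ν j) (fun _ => f) (u₀ j) (u j)) ∧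
      (∀ j (t : ℝ) (s : UnitAddCircle) (x : 𝕋³), u j t (x + Pi.single (2 : Fin 3) s) = u j t x) ∧
      (∃ E : ℝ, ∀ j, meanEnergy (u j) ≤ E) ∧
      ∃ ε : ℝ, 0 < ε ∧ ∀ j, ε ≤ meanDissipation (ν j) (u j)

/-- **Without `HasZeroMean f`, `X` is a theorem — through the `limsup` JUNK of `meanEnergy`:** fixed force
`(0,0,cos 2πx₀ + 1)` (mean `e₃`), accelerating laminar states `u_j(t) = (0,0,cos(2πx₀)/(4π²ν_j) + t)` (global
Leray–Hopf): Cesàro means of the energy grow like `T²/3`, so `meanEnergy = 0 ≤ 0` (junk, `Real.sInf ∅ = 0`),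
while the dissipation `(j+1)/(8π²)` is honest.  Reading: `HasZeroMean f` is exactly what makes the ceiling of
`X` honest (momentum conservation ⇒ bounded energies); a proof of `X` gains nothing from it, a disproof needs it.
Dual of `twohalfdNeg_false_without_zeroMeanForce`. [folklore] -/
theorem twohalfdThesisWithoutZeroMeanForce_holds : TwohalfdThesisWithoutZeroMeanForce := by
  have hν : ∀ j : ℕ, (0 : ℝ) < 1 / ((j : ℝ) + 1) := fun j => by positivity
  have ha : ∀ j : ℕ, 4 * Real.pi ^ 2 * (1 / ((j : ℝ) + 1)) * (((j : ℝ) + 1) / (4 * Real.pi ^ 2)) = 1 := by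
    intro j
    have hj : (j : ℝ) + 1 ≠ 0 := by positivity
    have hπ : (Real.pi : ℝ) ^ 2 ≠ 0 := by positivity
    field_simp
  have hsm : IsSmooth (rampForce 1) := isSmooth_zero₂.twoHalf (isSmooth_profile_add_const 1 1)
  have hdf : IsDivFree (rampForce 1) :=
    IsDivFree.twoHalf (fun x => by simp [Torus.divergence, Torus.partialDeriv, Torus.lineDeriv]) _
  refine ⟨rampForce 1, twoHalf_zero_add_single _, hsm, hdf, fun j => 1 / ((j : ℝ) + 1),
    fun j => rampState (((j : ℝ) + 1) / (4 * Real.pi ^ 2)) 1 0,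
    fun j => rampState (((j : ℝ) + 1) / (4 * Real.pi ^ 2)) 1, hν, tendsto_one_div_add_atTop_nhds_zero_nat,
    fun j => isGlobalLerayHopf_ramp (ha j) 1, fun j t s x => twoHalf_zero_add_single _ s x,
    ⟨0, fun j => (meanEnergy_rampState _ one_ne_zero).le⟩, 1 / (8 * Real.pi ^ 2), by positivity, fun j => ?_⟩
  rw [meanDissipation_rampState]
  have hj : (0 : ℝ) < (j : ℝ) + 1 := by positivity
  have hπ : (0 : ℝ) < Real.pi ^ 2 := by positivity
  have heq : 1 / ((j : ℝ) + 1) * (2 * Real.pi ^ 2 * (((j : ℝ) + 1) / (4 * Real.pi ^ 2)) ^ 2) =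
      ((j : ℝ) + 1) / (8 * Real.pi ^ 2) := by
    field_simp
    ring
  rw [heq]
  exact div_le_div_of_nonneg_right (by linarith) (by positivity)

/-- `X` with the energy ceiling RELAXED to `∃ E, ∀ j, meanEnergy (u j) ≤ E / ν j` (everything else verbatim). -/
def TwohalfdThesisEnergyInvNu : Prop :=
  ∃ f : 𝕋³ → E³, (∀ (s : UnitAddCircle) (x : 𝕋³), f (x + Pi.single (2 : Fin 3) s) = f x) ∧
    IsSmooth f ∧ IsDivFree f ∧ HasZeroMean f ∧
    ∃ (ν : ℕ → ℝ) (u₀ : ℕ → 𝕋³ → E³) (u : ℕ → ℝ → 𝕋³ → E³),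
      (∀ j, 0 < ν j) ∧ Tendsto ν atTop (𝓝 0) ∧
      (∀ j, IsGlobalLerayHopf (ν j) (fun _ => f) (u₀ j) (u j)) ∧
      (∀ j (t : ℝ) (s : UnitAddCircle) (x : 𝕋³), u j t (x + Pi.single (2 : Fin 3) s) = u j t x) ∧
      (∃ E : ℝ, ∀ j, meanEnergy (u j) ≤ E / ν j) ∧
      ∃ ε : ℝ, 0 < ε ∧ ∀ j, ε ≤ meanDissipation (ν j) (u j)

/-- **With the ceiling relaxed to `O(ν⁻¹)`, `X` is a theorem** (the ceiling exponent `-1` is the exact laminar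
threshold): the SAME fixed force `(0,0,cos 2πx₀)`, `ν_j = (j+1)⁻²`, steady Galilean-SWEPT shear states with
planar drift `√ν_j` (`sweptState`, sibling file `SweptThreshold.lean`): energy `≤ 2/ν_j`, dissipation
`≥ 1/(2+8π²)`.  So ¬X must exploit the ceiling at the scale `E ≪ ν⁻¹` (bounds `D ≲ (νE)^a` are consistent);
and a PROOF of `X` cannot come from detuned laminar responses: their dissipation is `ν × 4π²|k|² × (energy)`.
Dual of `twohalfdNeg_false_energyInvNu`. [folklore] -/
theorem twohalfdThesisEnergyInvNu_holds : TwohalfdThesisEnergyInvNu := by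
  set q : ℕ → ℝ := fun j => (1 / ((j : ℝ) + 1)) ^ 2 with hq
  have hq0 : ∀ j, 0 < q j := fun j => by positivity
  have hq1 : ∀ j, q j ≤ 1 := fun j => by
    have hj : (1 : ℝ) ≤ (j : ℝ) + 1 := by
      have := (Nat.cast_nonneg j : (0 : ℝ) ≤ j)
      linarith
    simp only [hq, div_pow, one_pow]
    exact div_le_one_of_le₀ (by nlinarith) (by positivity)
  have hν0 : Tendsto q atTop (𝓝 0) := by
    show Tendsto (fun j : ℕ => (1 / ((j : ℝ) + 1)) ^ 2) atTop (𝓝 0)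
    simpa using (tendsto_one_div_add_atTop_nhds_zero_nat (𝕜 := ℝ)).pow 2
  have hz : ∀ j, sweptDen (q j) (1 / ((j : ℝ) + 1)) * sweptAmp (q j) (1 / ((j : ℝ) + 1)) =
      (((1 : ℝ) / 2 : ℝ) : ℂ) :=
    fun j => sweptDen_mul_sweptAmp (hq0 j).ne' _
  have hsq : ∀ j : ℕ, (2 * Real.pi * (1 / ((j : ℝ) + 1))) ^ 2 = 4 * Real.pi ^ 2 * q j := fun j => by
    simp only [hq]
    ring
  refine ⟨shear 0 1, shear_add_single 0 1, isSmooth_shear 0 1, isDivFree_shear 0 1, hasZeroMean_shear 0 1,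
    q, fun j => sweptState (1 / ((j : ℝ) + 1)) (sweptAmp (q j) (1 / ((j : ℝ) + 1))),
    fun j _ => sweptState (1 / ((j : ℝ) + 1)) (sweptAmp (q j) (1 / ((j : ℝ) + 1))), hq0, hν0,
    fun j => isGlobalLerayHopf_swept (hz j), fun j _ s x => sweptState_add_single _ _ s x,
    ⟨2, fun j => ?_⟩, 1 / (2 + 8 * Real.pi ^ 2), by positivity, fun j => ?_⟩
  · rw [meanEnergy_sweptState, norm_sq_sweptAmp, hsq]
    exact swept_energy_upper (hq0 j) (hq1 j)
  · rw [meanDissipation_sweptState, norm_sq_sweptAmp, hsq]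
    exact swept_dissipation_lower (hq0 j) (hq1 j)

end Relaxations

/-! ## §3 Anatomy of a witness: necessary conditions at the Leray–Hopf level -/

section Anatomy

/-- **The data of an `X`-witness, bundled** (one fixed force `f`, viscosities `ν`, data `u₀`, solutions `u`,
energy ceiling `E`, dissipation floor `ε`), so that necessary conditions read `IsWitness … → …`. -/
structure IsWitness (f : 𝕋³ → E³) (ν : ℕ → ℝ) (u₀ : ℕ → 𝕋³ → E³) (u : ℕ → ℝ → 𝕋³ → E³) (E ε : ℝ) :
    Prop where
  /-- `f` is `x₃`-invariant. -/
  force_inv : ∀ (s : UnitAddCircle) (x : 𝕋³), f (x + Pi.single (2 : Fin 3) s) = f x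
  /-- `f ∈ C^∞`. -/
  smooth : IsSmooth f
  /-- `div f = 0`. -/
  divFree : IsDivFree f
  /-- `∫ f = 0`. -/
  zeroMean : HasZeroMean f
  /-- `ν_j > 0`. -/
  visc_pos : ∀ j, 0 < ν j
  /-- `ν_j → 0`. -/
  visc_tendsto : Tendsto ν atTop (𝓝 0)
  /-- each `u_j` is a global Leray–Hopf solution of NS_{ν_j} forced by `f`. -/
  lerayHopf : ∀ j, IsGlobalLerayHopf (ν j) (fun _ => f) (u₀ j) (u j)
  /-- each `u_j` is `x₃`-invariant. -/
  sol_inv : ∀ j (t : ℝ) (s : UnitAddCircle) (x : 𝕋³), u j t (x + Pi.single (2 : Fin 3) s) = u j t x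
  /-- the energy ceiling. -/
  energy_le : ∀ j, meanEnergy (u j) ≤ E
  /-- `ε > 0`. -/
  eps_pos : 0 < ε
  /-- the dissipation floor. -/
  eps_le : ∀ j, ε ≤ meanDissipation (ν j) (u j)

/-- `X` is the existence of a witness (definitional repackaging). [folklore] -/
theorem twohalfdThesis_iff_exists_isWitness :
    TwohalfdThesis ↔ ∃ f ν u₀ u E ε, IsWitness f ν u₀ u E ε := by
  constructor
  · rintro ⟨f, hfinv, hs, hd, hz, ν, u₀, u, hν, hν0, hLH, huinv, ⟨E, hE⟩, ε, hε, hεj⟩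
    exact ⟨f, ν, u₀, u, E, ε, ⟨hfinv, hs, hd, hz, hν, hν0, hLH, huinv, hE, hε, hεj⟩⟩
  · rintro ⟨f, ν, u₀, u, E, ε, h⟩
    exact ⟨f, h.force_inv, h.smooth, h.divFree, h.zeroMean, ν, u₀, u, h.visc_pos, h.visc_tendsto, h.lerayHopf,
      h.sol_inv, ⟨E, h.energy_le⟩, ε, h.eps_pos, h.eps_le⟩

variable {f : 𝕋³ → E³} {ν : ℕ → ℝ} {u₀ : ℕ → 𝕋³ → E³} {u : ℕ → ℝ → 𝕋³ → E³} {E ε : ℝ}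

/-- **Power floor.** At every level the fixed force injects mean power `⟨f, u_j⟩ ≥ ε`
(Doering–Foias / Cheskidov–Doering–Petrov eq. (11), in tree: `DoeringFoias2002_dissipation_le_power_holds`,
the Leray–Hopf energy inequality time-averaged).  Since `f̂` lives at `|k| = O(1)`, the LOW modes of `u_j` must
stay correlated with `f` uniformly in `j`. [cite: CheskidovDoeringPetrov2006, eq. (11)] -/
theorem IsWitness.eps_le_meanPower (h : IsWitness f ν u₀ u E ε) (j : ℕ) : ε ≤ meanPower f (u j) :=
  (h.eps_le j).trans
    (DoeringFoias2002_dissipation_le_power_holds (h.visc_pos j) (h.smooth.memLp 2) h.zeroMean (u₀ j) (u j)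
      (h.lerayHopf j))

/-- **Power ceiling** `⟨f, u_j⟩ ≤ ‖f‖₂ √⟨‖u_j‖²⟩` (Cauchy–Schwarz in space, Jensen in time; in tree:
`Torus.IsGlobalLerayHopf.meanPower_le`). [cite: CheskidovDoeringPetrov2006, eq. (17)] -/
theorem IsWitness.meanPower_le (h : IsWitness f ν u₀ u E ε) (j : ℕ) :
    meanPower f (u j) ≤ Real.sqrt (∫ x, ‖f x‖ ^ 2) * Real.sqrt (meanEnergy (u j)) := by
  have := Torus.IsGlobalLerayHopf.meanPower_le (h.visc_pos j) h.smooth h.zeroMean (h.lerayHopf j)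
  rwa [rmsVelocity_eq_sqrt_meanEnergy] at this

/-- **`ε ≤ ‖f‖₂ √E`**: the three budgets of `X` are coupled (Doering–Foias). [cite: DoeringFoias2002, §2] -/
theorem IsWitness.eps_le_norm_mul_sqrt (h : IsWitness f ν u₀ u E ε) :
    ε ≤ Real.sqrt (∫ x, ‖f x‖ ^ 2) * Real.sqrt E :=
  ((h.eps_le_meanPower 0).trans (h.meanPower_le 0)).trans
    (mul_le_mul_of_nonneg_left (Real.sqrt_le_sqrt (h.energy_le 0)) (Real.sqrt_nonneg _))

/-- The witness force is nonzero in `L²`. [folklore] -/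
theorem IsWitness.integral_norm_sq_force_pos (h : IsWitness f ν u₀ u E ε) : 0 < ∫ x, ‖f x‖ ^ 2 := by
  by_contra h0
  have h0' : ∫ x, ‖f x‖ ^ 2 = 0 := le_antisymm (not_lt.1 h0) (integral_nonneg fun _ => sq_nonneg _)
  have := h.eps_le_norm_mul_sqrt
  rw [h0', Real.sqrt_zero, zero_mul] at this
  exact absurd this (not_le.2 h.eps_pos)

/-- **The energy ceiling of a witness is positive** (indeed `E ≥ ε²/‖f‖₂²`). [folklore] -/
theorem IsWitness.energy_pos (h : IsWitness f ν u₀ u E ε) : 0 < E := by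
  by_contra hE
  have hE' : Real.sqrt E = 0 := Real.sqrt_eq_zero'.2 (not_lt.1 hE)
  have := h.eps_le_norm_mul_sqrt
  rw [hE', mul_zero] at this
  exact absurd this (not_le.2 h.eps_pos)

/-- **`ε² ≤ ‖f‖₂² · E`** (squared form of the Doering–Foias coupling). [cite: DoeringFoias2002, §2] -/
theorem IsWitness.eps_sq_le (h : IsWitness f ν u₀ u E ε) : ε ^ 2 ≤ (∫ x, ‖f x‖ ^ 2) * E := by
  have h1 := h.eps_le_norm_mul_sqrt
  have hf0 : 0 ≤ ∫ x, ‖f x‖ ^ 2 := integral_nonneg fun _ => sq_nonneg _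
  have h2 : ε ^ 2 ≤ (Real.sqrt (∫ x, ‖f x‖ ^ 2) * Real.sqrt E) ^ 2 :=
    pow_le_pow_left₀ h.eps_pos.le h1 2
  rwa [mul_pow, Real.sq_sqrt hf0, Real.sq_sqrt h.energy_pos.le] at h2

/-- The mean enstrophy `⟨‖∇u‖²⟩` (spectral, `toReal`, `limsup` of Cesàro means — same conventions as
`meanDissipation`). -/
def meanEnstrophy (v : ℝ → 𝕋³ → E³) : ℝ :=
  longTimeAvgSup fun t => (eGradNormSq (v t)).toReal

/-- `meanDissipation ν u = ν · meanEnstrophy u` for `ν ≥ 0` (nonnegative constants leave the `limsup`,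
`longTimeAvgSup_const_mul`, junk included). [folklore] -/
theorem meanDissipation_eq_mul_meanEnstrophy {ν' : ℝ} (hν : 0 ≤ ν') (v : ℝ → 𝕋³ → E³) :
    meanDissipation ν' v = ν' * meanEnstrophy v := by
  unfold meanDissipation meanEnstrophy
  exact longTimeAvgSup_const_mul hν _

/-- The mean enstrophy is nonnegative (junk included). [folklore] -/
theorem meanEnstrophy_nonneg (v : ℝ → 𝕋³ → E³) : 0 ≤ meanEnstrophy v :=
  longTimeAvgSup_nonneg fun _ => ENNReal.toReal_nonneg

/-- **Enstrophy floor**: `⟨‖∇u_j‖²⟩ ≥ ε/ν_j` at every level. [folklore] -/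
theorem IsWitness.enstrophy_ge (h : IsWitness f ν u₀ u E ε) (j : ℕ) : ε / ν j ≤ meanEnstrophy (u j) := by
  rw [div_le_iff₀ (h.visc_pos j), mul_comm, ← meanDissipation_eq_mul_meanEnstrophy (h.visc_pos j).le]
  exact h.eps_le j

/-- **The mean enstrophy of a witness family blows up**: `⟨‖∇u_j‖²⟩ → ∞` (witnesses are genuinely
multi-scale: power enters at `|k| = O(1)`, gradients live at `|k| ~ ν_j^{-1/2}`). [folklore] -/
theorem IsWitness.tendsto_meanEnstrophy_atTop (h : IsWitness f ν u₀ u E ε) :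
    Tendsto (fun j => meanEnstrophy (u j)) atTop atTop := by
  have hdiv : Tendsto (fun j => ε / ν j) atTop atTop := by
    have hinv : Tendsto (fun j => (ν j)⁻¹) atTop atTop :=
      (tendsto_inv_nhdsGT_zero (𝕜 := ℝ)).comp
        (tendsto_nhdsWithin_iff.2 ⟨h.visc_tendsto, Eventually.of_forall fun j => h.visc_pos j⟩)
    simpa [div_eq_mul_inv] using hinv.const_mul_atTop h.eps_pos
  exact tendsto_atTop_mono (fun j => h.enstrophy_ge j) hdiv

/-- `X` STRENGTHENED by a `ν`-uniform bound on the mean enstrophy, `∃ M, ∀ j, ⟨‖∇u_j‖²⟩ ≤ M`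
(everything else verbatim). -/
def TwohalfdThesisBoundedEnstrophy : Prop :=
  ∃ f : 𝕋³ → E³, (∀ (s : UnitAddCircle) (x : 𝕋³), f (x + Pi.single (2 : Fin 3) s) = f x) ∧
    IsSmooth f ∧ IsDivFree f ∧ HasZeroMean f ∧
    ∃ (ν : ℕ → ℝ) (u₀ : ℕ → 𝕋³ → E³) (u : ℕ → ℝ → 𝕋³ → E³),
      (∀ j, 0 < ν j) ∧ Tendsto ν atTop (𝓝 0) ∧
      (∀ j, IsGlobalLerayHopf (ν j) (fun _ => f) (u₀ j) (u j)) ∧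
      (∀ j (t : ℝ) (s : UnitAddCircle) (x : 𝕋³), u j t (x + Pi.single (2 : Fin 3) s) = u j t x) ∧
      (∃ E : ℝ, ∀ j, meanEnergy (u j) ≤ E) ∧
      (∃ M : ℝ, ∀ j, meanEnstrophy (u j) ≤ M) ∧
      ∃ ε : ℝ, 0 < ε ∧ ∀ j, ε ≤ meanDissipation (ν j) (u j)

/-- **The bounded-enstrophy strengthening of `X` is FALSE** (`ε ≤ ν_j ⟨‖∇u_j‖²⟩ ≤ ν_j M → 0`): no
`ν`-uniformly `H¹`-bounded family — in particular no family of `ν`-uniformly Lipschitz flows, no fixed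
finite-dimensional Galerkin class — can witness `X`. [folklore] -/
theorem not_twohalfdThesisBoundedEnstrophy : ¬ TwohalfdThesisBoundedEnstrophy := by
  rintro ⟨f, hfinv, hs, hd, hz, ν, u₀, u, hν, hν0, hLH, huinv, ⟨E, hE⟩, ⟨M, hM⟩, ε, hε, hεj⟩
  have hw : IsWitness f ν u₀ u E ε := ⟨hfinv, hs, hd, hz, hν, hν0, hLH, huinv, hE, hε, hεj⟩
  have ht := hw.tendsto_meanEnstrophy_atTop
  obtain ⟨j, hj⟩ := (ht.eventually_gt_atTop M).exists
  exact (not_lt.2 (hM j)) hj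

/-- **Any subsequence of a witness family is a witness family** (all clauses are level-wise or limits). [folklore] -/
theorem IsWitness.comp_strictMono (h : IsWitness f ν u₀ u E ε) {φ : ℕ → ℕ} (hφ : StrictMono φ) :
    IsWitness f (ν ∘ φ) (u₀ ∘ φ) (u ∘ φ) E ε :=
  ⟨h.force_inv, h.smooth, h.divFree, h.zeroMean, fun j => h.visc_pos (φ j), h.visc_tendsto.comp hφ.tendsto_atTop,
    fun j => h.lerayHopf (φ j), fun j => h.sol_inv (φ j), fun j => h.energy_le (φ j), h.eps_pos,
    fun j => h.eps_le (φ j)⟩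

/-- **WLOG `ν_j ≤ 1` (indeed `ν_j ≤` any `δ > 0`)**: pass to a tail. [folklore] -/
theorem IsWitness.exists_visc_le (h : IsWitness f ν u₀ u E ε) {δ : ℝ} (hδ : 0 < δ) :
    ∃ φ : ℕ → ℕ, StrictMono φ ∧ IsWitness f (ν ∘ φ) (u₀ ∘ φ) (u ∘ φ) E ε ∧ ∀ j, ν (φ j) ≤ δ := by
  obtain ⟨N, hN⟩ := eventually_atTop.1 (h.visc_tendsto.eventually (Iic_mem_nhds hδ))
  refine ⟨fun j => j + N, fun a b hab => Nat.add_lt_add_right hab N, h.comp_strictMono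
    (fun a b hab => Nat.add_lt_add_right hab N), fun j => hN _ (Nat.le_add_left N j)⟩

end Anatomy

/-! ## §3b Energy floor: a fixed force pins the energy of ANY bounded-energy family from below -/

section EnergyFloor

variable {d : Type*} [Fintype d] [DecidableEq d]

/-- `div (c • g) = c · div g` on the torus, with no differentiability hypothesis (`deriv_const_mul_field`). [folklore] -/
theorem divergence_const_smul (c : ℝ) (g : UnitAddTorus d → EuclideanSpace ℝ d) (x : UnitAddTorus d) :
    Torus.divergence (c • g) x = c * Torus.divergence g x := by
  unfold Torus.divergence Torus.partialDeriv Torus.lineDeriv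
  rw [Finset.mul_sum]
  refine Finset.sum_congr rfl fun i _ => ?_
  simp only [Pi.smul_apply, PiLp.smul_apply, smul_eq_mul]
  exact deriv_const_mul_field c

/-- The `L²`-normalised shape `f/‖f‖₂` of a nonzero smooth solenoidal mean-zero field, as a Doering–Foias
`ForcingShape` (so that the tree's amplitude / Alexakis–Doering bounds apply to a GENERAL steady force:
`f = ‖f‖₂ · Φ(1 • x)`). [folklore] -/
def shapeOf (f : UnitAddTorus d → EuclideanSpace ℝ d) (hs : IsSmooth f) (hd : IsDivFree f) (hz : HasZeroMean f)
    (hA : 0 < ∫ x, ‖f x‖ ^ 2) : ForcingShape d where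
  shape := (Real.sqrt (∫ x, ‖f x‖ ^ 2))⁻¹ • f
  smooth := hs.smul _
  divFree := fun x => by rw [divergence_const_smul, hd x, mul_zero]
  zeroMean := by
    show ∫ x, ((Real.sqrt (∫ x, ‖f x‖ ^ 2))⁻¹ • f) x = 0
    simp_rw [Pi.smul_apply, integral_smul]
    rw [show (∫ x, f x) = 0 from hz, smul_zero]
  sq_norm_eq_one := by
    have hA' : 0 < Real.sqrt (∫ x, ‖f x‖ ^ 2) := Real.sqrt_pos.2 hA
    simp_rw [Pi.smul_apply, norm_smul, mul_pow, integral_const_mul, Real.norm_eq_abs, abs_inv, abs_of_pos hA',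
      inv_pow, Real.sq_sqrt hA.le]
    exact inv_mul_cancel₀ hA.ne'

variable {f : UnitAddTorus d → EuclideanSpace ℝ d} {hs : IsSmooth f} {hd : IsDivFree f} {hz : HasZeroMean f}
  {hA : 0 < ∫ x, ‖f x‖ ^ 2}

/-- The unit-amplitude force of `shapeOf f` is `f/‖f‖₂`. [folklore] -/
theorem shapeOf_force_one_one : (shapeOf f hs hd hz hA).force 1 1 = (Real.sqrt (∫ x, ‖f x‖ ^ 2))⁻¹ • f := by
  funext x
  simp [ForcingShape.force, shapeOf]

/-- The force of `shapeOf f` at amplitude `‖f‖₂` is `f` itself. [folklore] -/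
theorem shapeOf_force_one_norm : (shapeOf f hs hd hz hA).force 1 (Real.sqrt (∫ x, ‖f x‖ ^ 2)) = f := by
  funext x
  simp only [ForcingShape.force, shapeOf, one_smul, Pi.smul_apply, smul_smul]
  rw [mul_inv_cancel₀ (Real.sqrt_pos.2 hA).ne', one_smul]

omit hs hd hz hA in
/-- **Doering–Foias amplitude bound for a GENERAL steady smooth force** (Cheskidov–Doering–Petrov eq. (18) tested against the
force itself; in tree for `ForcingShape` forces: `DoeringFoias.abs_amplitude_le_of_isGlobalLerayHopf`): for every global
Leray–Hopf solution `u` of NS_ν on `T^d` driven by `f`,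
`‖f‖₂² ≤ C ⟨‖u‖²⟩ + ν K ⟨‖u‖²⟩^{1/2}` whenever `∑ᵢ‖∂ᵢf‖ ≤ C` and `‖Δf‖ ≤ K` pointwise. [cite: CheskidovDoeringPetrov2006, §III eq. (18)] -/
theorem integral_norm_sq_le_of_isGlobalLerayHopf {ν' : ℝ} (hν : 0 < ν') (hs : IsSmooth f) (hd : IsDivFree f)
    (hz : HasZeroMean f) {v₀ : UnitAddTorus d → EuclideanSpace ℝ d} {v : ℝ → UnitAddTorus d → EuclideanSpace ℝ d}
    (hu : IsGlobalLerayHopf ν' (fun _ => f) v₀ v)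
    {C K : ℝ} (hC : 0 ≤ C) (hK : 0 ≤ K) (hCf : ∀ x, ∑ i, ‖Torus.partialDeriv i f x‖ ≤ C)
    (hKf : ∀ x, ‖Torus.laplacian f x‖ ≤ K) :
    ∫ x, ‖f x‖ ^ 2 ≤ C * meanEnergy v + ν' * K * Real.sqrt (meanEnergy v) := by
  have hE0 : 0 ≤ meanEnergy v := meanEnergy_nonneg v
  by_cases hA : ∫ x, ‖f x‖ ^ 2 = 0
  · rw [hA]; positivity
  have hApos : 0 < ∫ x, ‖f x‖ ^ 2 := lt_of_le_of_ne (integral_nonneg fun _ => sq_nonneg _) (Ne.symm hA)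
  set A : ℝ := Real.sqrt (∫ x, ‖f x‖ ^ 2) with hAdef
  have hA0 : 0 < A := Real.sqrt_pos.2 hApos
  set Φ : ForcingShape d := shapeOf f hs hd hz hApos with hΦ
  have hu' : IsGlobalLerayHopf ν' (fun _ => Φ.force 1 A) v₀ v := by
    rw [show (fun _ : ℝ => Φ.force 1 A) = fun _ => f from funext fun _ => shapeOf_force_one_norm]
    exact hu
  have hf1 : Φ.force 1 1 = A⁻¹ • f := shapeOf_force_one_one
  have hC' : ∀ x, ∑ i, ‖Torus.partialDeriv i (Φ.force 1 1) x‖ ≤ C / A := by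
    intro x
    rw [hf1]
    have : ∀ i, ‖Torus.partialDeriv i (A⁻¹ • f) x‖ = A⁻¹ * ‖Torus.partialDeriv i f x‖ := fun i => by
      rw [partialDeriv_const_smul (hs.isContDiff (by simp)) A⁻¹ i, Pi.smul_apply, norm_smul, Real.norm_eq_abs,
        abs_of_pos (inv_pos.2 hA0)]
    simp_rw [this, ← Finset.mul_sum]
    rw [div_eq_inv_mul]
    exact mul_le_mul_of_nonneg_left (hCf x) (inv_pos.2 hA0).le
  have hK' : ∀ x, ‖Torus.laplacian (Φ.force 1 1) x‖ ≤ K / A := by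
    intro x
    rw [hf1, laplacian_const_smul_apply hs, norm_smul, Real.norm_eq_abs, abs_of_pos (inv_pos.2 hA0), div_eq_inv_mul]
    exact mul_le_mul_of_nonneg_left (hKf x) (inv_pos.2 hA0).le
  have h := DoeringFoias.abs_amplitude_le_of_isGlobalLerayHopf hν one_pos hu' (div_nonneg hC hA0.le) (div_nonneg hK hA0.le)
    hC' hK'
  rw [abs_of_pos hA0, rmsVelocity_eq_sqrt_meanEnergy, Real.sq_sqrt hE0] at h
  have h2 := mul_le_mul_of_nonneg_left h hA0.le
  have hAA : A * A = ∫ x, ‖f x‖ ^ 2 := by rw [hAdef, ← sq, Real.sq_sqrt hApos.le]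
  calc ∫ x, ‖f x‖ ^ 2 = A * A := hAA.symm
    _ ≤ A * (C / A * meanEnergy v + ν' * (K / A) * Real.sqrt (meanEnergy v)) := h2
    _ = C * meanEnergy v + ν' * K * Real.sqrt (meanEnergy v) := by field_simp

omit hs hd hz hA in
/-- **ENERGY FLOOR `‖f‖₂² ≤ ‖∇f‖_∞ · E` for EVERY bounded-energy Leray–Hopf family under a fixed steady force as `ν_j → 0`**
(precisely `∫‖f‖² ≤ C·E` for every pointwise bound `∑ᵢ‖∂ᵢf‖ ≤ C`): the amplitude bound at every level,
`‖f‖₂² ≤ C E + ν_j K √E`, pushed to `j → ∞`.  No dissipation hypothesis: witness or not, the energy ceiling of a family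
driven by `f` can never be below the force's own scale `‖f‖₂²/‖∇f‖_∞`. [cite: CheskidovDoeringPetrov2006, §III eq. (18)] -/
theorem integral_norm_sq_le_mul_of_family (hs : IsSmooth f) (hd : IsDivFree f) (hz : HasZeroMean f)
    {ν : ℕ → ℝ} (hν : ∀ j, 0 < ν j) (hν0 : Tendsto ν atTop (𝓝 0))
    {v₀ : ℕ → UnitAddTorus d → EuclideanSpace ℝ d} {v : ℕ → ℝ → UnitAddTorus d → EuclideanSpace ℝ d}
    (hu : ∀ j, IsGlobalLerayHopf (ν j) (fun _ => f) (v₀ j) (v j)) {E : ℝ} (hE : ∀ j, meanEnergy (v j) ≤ E)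
    {C : ℝ} (hC : 0 ≤ C) (hCf : ∀ x, ∑ i, ‖Torus.partialDeriv i f x‖ ≤ C) :
    ∫ x, ‖f x‖ ^ 2 ≤ C * E := by
  obtain ⟨K, hK, hKf⟩ := exists_nonneg_forall_norm_le_of_continuous (hs.laplacian).continuous
  have hj : ∀ j, ∫ x, ‖f x‖ ^ 2 ≤ C * E + ν j * K * Real.sqrt E := fun j => by
    have h1 := integral_norm_sq_le_of_isGlobalLerayHopf (hν j) hs hd hz (hu j) hC hK hCf hKf
    have hm : meanEnergy (v j) ≤ E := hE j
    have hm0 : 0 ≤ meanEnergy (v j) := meanEnergy_nonneg _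
    have hνK : 0 ≤ ν j * K := mul_nonneg (hν j).le hK
    nlinarith [mul_le_mul_of_nonneg_left hm hC, mul_le_mul_of_nonneg_left (Real.sqrt_le_sqrt hm) hνK]
  have ht : Tendsto (fun j => C * E + ν j * K * Real.sqrt E) atTop (𝓝 (C * E + 0 * K * Real.sqrt E)) :=
    tendsto_const_nhds.add ((hν0.mul_const K).mul_const _)
  rw [zero_mul, zero_mul, add_zero] at ht
  exact ge_of_tendsto' ht hj

end EnergyFloor

section EnergyFloorWitness

variable {f : 𝕋³ → E³}

/-- **ENERGY FLOOR OF A WITNESS: `‖f‖₂² ≤ ‖∇f‖_∞ · E`** (precisely: `∫‖f‖² ≤ C·E` for every pointwise bound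
`∑ᵢ‖∂ᵢf‖ ≤ C`).  From the amplitude bound at every level, `‖f‖₂² ≤ C E + ν_j K √E`, and `ν_j → 0`.  So the energy ceiling
of `X` can never be taken below the force's own scale `‖f‖₂²/‖∇f‖_∞` — this uses only bounded energy and the fixed force,
not the dissipation floor: it is a constraint on EVERY bounded-energy Leray–Hopf family under a fixed steady force as `ν → 0`
(the laminar branch `E ∝ ν⁻²` and the swept branch `E ≥ 1/(√2 π)` for `f = (0,0,cos 2πx₀)`, where the floor is `1/(4π)`, both
comply).  Combined with `ε ≤ ‖f‖₂√E`: the witness lives in `E ≥ max(‖f‖₂²/‖∇f‖_∞, ε²/‖f‖₂²)`. [cite: CheskidovDoeringPetrov2006, §III eq. (18)] -/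
theorem IsWitness.integral_norm_sq_le_mul_energy {ν : ℕ → ℝ} {u₀ : ℕ → 𝕋³ → E³} {u : ℕ → ℝ → 𝕋³ → E³} {E ε : ℝ}
    (h : IsWitness f ν u₀ u E ε) {C : ℝ} (hC : 0 ≤ C) (hCf : ∀ x, ∑ i, ‖Torus.partialDeriv i f x‖ ≤ C) :
    ∫ x, ‖f x‖ ^ 2 ≤ C * E :=
  integral_norm_sq_le_mul_of_family h.smooth h.divFree h.zeroMean h.visc_pos h.visc_tendsto h.lerayHopf h.energy_le hC hCf

end EnergyFloorWitness

/-! ## §4 Near-misses: sub-classes where `X` is false on paper (formal obstruction = 2½-D descent) -/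

section NearMisses

/-- `X` restricted to VERTICAL forces `f = (0,0,h(x₁,x₂))` (= `twoHalf 0 h`). -/
def TwohalfdThesisVerticalForce : Prop :=
  ∃ h : UnitAddTorus (Fin 2) → ℝ, IsSmooth h ∧ HasZeroMean h ∧
    ∃ (ν : ℕ → ℝ) (u₀ : ℕ → 𝕋³ → E³) (u : ℕ → ℝ → 𝕋³ → E³),
      (∀ j, 0 < ν j) ∧ Tendsto ν atTop (𝓝 0) ∧
      (∀ j, IsGlobalLerayHopf (ν j) (fun _ => twoHalf 0 h) (u₀ j) (u j)) ∧
      (∀ j (t : ℝ) (s : UnitAddCircle) (x : 𝕋³), u j t (x + Pi.single (2 : Fin 3) s) = u j t x) ∧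
      (∃ E : ℝ, ∀ j, meanEnergy (u j) ≤ E) ∧
      ∃ ε : ℝ, 0 < ε ∧ ∀ j, ε ≤ meanDissipation (ν j) (u j)

/-- **NEAR-MISS (vertical force): `X` is false for `f = (0,0,h)` — paper proof, not yet formal.**
PAPER: the planar part `v_j` of `u_j = (v_j,w_j)∘π` solves UNFORCED 2-D Navier–Stokes, so
`‖v_j(t) - m_j‖₂ ≤ e^{-4π²ν_jt}‖v_j(0) - m_j‖₂` (`m_j` = conserved planar momentum); the long-time means of
`w_j` are those of the laminar state swept by the drift `m_j`:
`E_{j,k} = |ĥ_k|²/(16π⁴ν_j²|k|⁴ + 4π²(m_j·k)²)`, `D_j = ∑_k 4π²ν_j|k|²E_{j,k}`; with `∑_k E_{j,k} ≤ E` and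
`E_{j,k} ≤ |ĥ_k|²/(16π⁴ν_j²|k|⁴)`: `D_j ≤ 4π²ν_jK²E + √E ∑_{|k|>K}|ĥ_k| → 0` (head/tail, `ĥ ∈ ℓ¹`).
FORMAL PLAN / OBSTRUCTION: (1) descent of the `x₃`-invariant Leray–Hopf solution to a 2-D weak solution `v_j`
in `L^∞L² ∩ L²H¹` + a weak sourced scalar `w_j` (Fubini with the test fields `twoHalf ψ 0`, `twoHalf 0 φ`;
tree: `TwoHalfSection`, `TwoHalfSpectralSplit`, `eq_twoHalf_of_forall_add_single'`); (2) 2-D energy EQUALITY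
for `v_j` (Lions–Prodi class; on `T²` NOT in tree — `lions_energy_equality_L4_holds` is on `ℝ³`), giving the
decay; (3) linear stability of the swept laminar scalar state under an `L²`-exponentially decaying drift
perturbation and shift-invariance of `longTimeAvgSup`; (4) the head/tail estimate (pure `tsum` algebra).
Steps (1)–(2) are the common obstruction of this section. [folklore] -/
theorem not_twohalfdThesisVerticalForce : ¬ TwohalfdThesisVerticalForce := by
  sorry

/-- `X` restricted to PLANAR forces `f = (g₁,g₂,0)(x₁,x₂)` (= `twoHalf g 0`): the third component is unforced. -/
def TwohalfdThesisPlanarForce : Prop :=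
  ∃ g : UnitAddTorus (Fin 2) → EuclideanSpace ℝ (Fin 2), IsSmooth g ∧ IsDivFree g ∧ HasZeroMean g ∧
    ∃ (ν : ℕ → ℝ) (u₀ : ℕ → 𝕋³ → E³) (u : ℕ → ℝ → 𝕋³ → E³),
      (∀ j, 0 < ν j) ∧ Tendsto ν atTop (𝓝 0) ∧
      (∀ j, IsGlobalLerayHopf (ν j) (fun _ => twoHalf g 0) (u₀ j) (u j)) ∧
      (∀ j (t : ℝ) (s : UnitAddCircle) (x : 𝕋³), u j t (x + Pi.single (2 : Fin 3) s) = u j t x) ∧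
      (∃ E : ℝ, ∀ j, meanEnergy (u j) ≤ E) ∧
      ∃ ε : ℝ, 0 < ε ∧ ∀ j, ε ≤ meanDissipation (ν j) (u j)

/-- **NEAR-MISS (planar force): `X` is false for `f = (g,0)` — the third component MUST be sourced.**
PAPER: `ε ≤ ⟨ν_j‖∇u_j‖²⟩ ≤ ⟨f,u_j⟩ = ⟨g,v_j⟩` (Doering–Foias, in tree; the unforced scalar `w_j` drops out of
the power), and for the 2-D Leray–Hopf solution `v_j` the energy EQUALITY gives `⟨g,v_j⟩ = ν_j⟨‖∇v_j‖²⟩`, which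
is `O(ν_j^{1/2})` at bounded energy by Alexakis–Doering (in tree, PROVED for 2-D Leray–Hopf solutions:
`Literature.Barriers.AnomalousDissipation.no_twoDimensional_zerothLaw`, smooth datum / `U_j > 0` provisos
removable by an a.e.-`H¹` restart and by `⟨g,v⟩ ≤ ‖g‖U`).  FORMAL PLAN / OBSTRUCTION: descent (§4 head) +
2-D energy equality on `T²` (power = dissipation for `v_j`) + restart/shift-invariance of the long-time means;
everything else is in the tree.  §5 below CARRIES THIS OUT for smooth data modulo the single named gap
`PlanarDescentEnergyEq` (`not_twohalfdThesisPlanarForceSmoothData_of_descent`, sorry-free); what remains here beyond §5 is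
only the a.e.-`H¹` restart removing the smooth-datum proviso of the tree's Alexakis–Doering theorem. [folklore] -/
theorem not_twohalfdThesisPlanarForce : ¬ TwohalfdThesisPlanarForce := by
  sorry

/-- `X` restricted to SINGLE-SHELL forces: `f` a Stokes eigenfield, `Δf = -4π²K f` (all of `f̂` on `|k|² = K`). -/
def TwohalfdThesisSingleShell : Prop :=
  ∃ (K : ℕ) (f : 𝕋³ → E³), (∀ (s : UnitAddCircle) (x : 𝕋³), f (x + Pi.single (2 : Fin 3) s) = f x) ∧
    IsSmooth f ∧ IsDivFree f ∧ HasZeroMean f ∧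
    (∀ x, Torus.laplacian f x = -(4 * Real.pi ^ 2 * (K : ℝ)) • f x) ∧
    ∃ (ν : ℕ → ℝ) (u₀ : ℕ → 𝕋³ → E³) (u : ℕ → ℝ → 𝕋³ → E³),
      (∀ j, 0 < ν j) ∧ Tendsto ν atTop (𝓝 0) ∧
      (∀ j, IsGlobalLerayHopf (ν j) (fun _ => f) (u₀ j) (u j)) ∧
      (∀ j (t : ℝ) (s : UnitAddCircle) (x : 𝕋³), u j t (x + Pi.single (2 : Fin 3) s) = u j t x) ∧
      (∃ E : ℝ, ∀ j, meanEnergy (u j) ≤ E) ∧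
      ∃ ε : ℝ, 0 < ε ∧ ∀ j, ε ≤ meanDissipation (ν j) (u j)

/-- **NEAR-MISS (single shell): `X` is false when `f` is a Stokes eigenfield** (the refuter design constraint
"`g` must span ≥ 2 shell radii" of the route text, evidence SINGLE_SHELL_2HALFD.md on stmt-0448).  PAPER: for
the planar part, energy equality `ν⟨‖∇v‖²⟩ = ⟨g,v⟩` and enstrophy balance `ν⟨‖Δv‖²⟩ = ⟨-Δg,v⟩ = 4π²K⟨g,v⟩`
(Tran–Shepherd / Alexakis–Doering §4; tree: `fmrt_enstrophy_balance_torus2_holds`) give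
`⟨‖Δv_j‖²⟩ = 4π²K⟨‖∇v_j‖²⟩`, whence by Cauchy–Schwarz `⟨‖∇v_j‖²⟩ ≤ 4π²K·E` UNIFORMLY in `ν`: the planar
flow is `ν`-uniformly bounded in time-mean `H¹` (even `H²`), its dissipation is `O(ν)`, and the sourced scalar
`w_j` renormalises against the Sobolev limit drift (DiPerna–Lions), so `⟨h,w_j⟩ → ⟨h,w⟩ = 0` along
subsequences and `ν_j⟨‖∇w_j‖²⟩ → 0`.  FORMAL PLAN / OBSTRUCTION: descent + 2-D energy equality (as above) +
enstrophy balance from an a.e.-`H¹` restart + a DiPerna–Lions commutator lemma for `W^{1,2}` planar drifts with a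
steady `L²` source in the long-time-average form (not in tree in this form; finite-window renormalisation tools:
`PassiveScalarRenormalizedSlice`, `PassiveScalarCommutatorSobolev`). [folklore] -/
theorem not_twohalfdThesisSingleShell : ¬ TwohalfdThesisSingleShell := by
  sorry

end NearMisses

/-! ## §5 The planar-force no-go, reduced to ONE classical gap (2½-D descent with the 2-D energy equality) -/

section PlanarDescent

/-- Local notation: the flat two-torus. -/
local notation "𝕋²" => UnitAddTorus (Fin 2)
/-- Local notation: planar velocity values. -/
local notation "E²" => EuclideanSpace ℝ (Fin 2)

/-- The planar part `y ↦ (U₁,U₂)(y,0)` of a field on `T³` (meaningful for `x₃`-invariant `U`). -/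
def planarPart (U : 𝕋³ → E³) : 𝕋² → E² := fun y => planarProjE (U (planarSect y))

/-- The vertical part `y ↦ U₃(y,0)` of a field on `T³` (meaningful for `x₃`-invariant `U`). -/
def verticalPart (U : 𝕋³ → E³) : 𝕋² → ℝ := fun y => U (planarSect y) 2

variable {U : 𝕋³ → E³}

/-- An `x₃`-invariant field is the `2½`-D lift of its parts (`Torus.eq_twoHalf_of_forall_add_single'`). [folklore] -/
theorem eq_twoHalf_parts (hU : ∀ (s : UnitAddCircle) (x : 𝕋³), U (x + Pi.single (2 : Fin 3) s) = U x) :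
    U = twoHalf (planarPart U) (verticalPart U) :=
  eq_twoHalf_of_forall_add_single' hU

/-- The parts of an `x₃`-invariant `L²` field are `L²`. [folklore] -/
theorem memLp_parts (hU : ∀ (s : UnitAddCircle) (x : 𝕋³), U (x + Pi.single (2 : Fin 3) s) = U x)
    (h2 : MemLp U 2 volume) : MemLp (planarPart U) 2 volume ∧ MemLp (verticalPart U) 2 volume := by
  rw [eq_twoHalf_parts hU] at h2
  exact memLp_of_twoHalf h2

/-- The planar energy is dominated by the total energy: `∫‖v‖² ≤ ∫‖U‖²`. [folklore] -/
theorem integral_norm_sq_planarPart_le (hU : ∀ (s : UnitAddCircle) (x : 𝕋³), U (x + Pi.single (2 : Fin 3) s) = U x)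
    (h2 : MemLp U 2 volume) : ∫ y, ‖planarPart U y‖ ^ 2 ≤ ∫ x, ‖U x‖ ^ 2 := by
  obtain ⟨hV, hR⟩ := memLp_parts hU h2
  conv_rhs => rw [eq_twoHalf_parts hU, integral_norm_sq_twoHalf_of_memLp hV hR]
  have : 0 ≤ ∫ y, verticalPart U y ^ 2 := integral_nonneg fun _ => sq_nonneg _
  linarith

/-- **A planar force only works on the planar part**: `∫⟪(g,0)∘π, U⟫ = ∫⟪g, v⟫`. [folklore] -/
theorem integral_inner_twoHalf_zero_left {g : 𝕋² → E²} (hg : MemLp g 2 volume)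
    (hU : ∀ (s : UnitAddCircle) (x : 𝕋³), U (x + Pi.single (2 : Fin 3) s) = U x) (h2 : MemLp U 2 volume) :
    ∫ x, ⟪twoHalf g 0 x, U x⟫_ℝ = ∫ y, ⟪g y, planarPart U y⟫_ℝ := by
  obtain ⟨hV, -⟩ := memLp_parts hU h2
  conv_lhs => rw [eq_twoHalf_parts hU]
  have hc : ∀ x, ⟪twoHalf g 0 x, twoHalf (planarPart U) (verticalPart U) x⟫_ℝ =
      ⟪twoHalf (planarPart U) (verticalPart U) x, twoHalf g 0 x⟫_ℝ := fun x => real_inner_comm _ _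
  simp_rw [hc, integral_inner_twoHalf_planar hV hg]
  exact integral_congr_ae (ae_of_all _ fun y => real_inner_comm _ _)

/-- Long-time averages only see the observable on `(0, ∞)`. [folklore] -/
theorem longTimeAvgSup_congr_Ioi {a b : ℝ → ℝ} (h : ∀ t, 0 < t → a t = b t) : longTimeAvgSup a = longTimeAvgSup b := by
  unfold longTimeAvgSup
  refine limsup_congr ?_
  filter_upwards [eventually_gt_atTop (0 : ℝ)] with T hT
  unfold timeMean
  rw [intervalIntegral.integral_of_le hT.le, intervalIntegral.integral_of_le hT.le,
    setIntegral_congr_fun measurableSet_Ioc fun t ht => h t ht.1]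

variable {u : ℝ → 𝕋³ → E³}

/-- **The mean power of a planar force is the planar mean power**: `⟨(g,0)∘π, u⟩ = ⟨g, v⟩` for an `x₃`-invariant flow
with `L²` slices at positive times. [folklore] -/
theorem meanPower_twoHalf_zero {g : 𝕋² → E²} (hg : MemLp g 2 volume)
    (hinv : ∀ (t : ℝ) (s : UnitAddCircle) (x : 𝕋³), u t (x + Pi.single (2 : Fin 3) s) = u t x)
    (h2 : ∀ t, 0 < t → MemLp (u t) 2 volume) :
    meanPower (twoHalf g 0) u = meanPower g (fun t => planarPart (u t)) :=
  longTimeAvgSup_congr_Ioi fun t ht => integral_inner_twoHalf_zero_left hg (hinv t) (h2 t ht)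

/-- **The planar mean energy is dominated by the total mean energy** (honest `limsup`s: the running means of the energy of
a Leray–Hopf solution under a steady smooth mean-zero force are bounded, `Torus.IsGlobalLerayHopf.timeMean_norm_sq_le`). [folklore] -/
theorem meanEnergy_planarPart_le {ν' : ℝ} (hν : 0 < ν') {F : 𝕋³ → E³} (hF : IsSmooth F) (hF0 : HasZeroMean F)
    {u₀ : 𝕋³ → E³} (hu : IsGlobalLerayHopf ν' (fun _ => F) u₀ u)
    (hinv : ∀ (t : ℝ) (s : UnitAddCircle) (x : 𝕋³), u t (x + Pi.single (2 : Fin 3) s) = u t x) :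
    meanEnergy (fun t => planarPart (u t)) ≤ meanEnergy u := by
  rw [meanEnergy_eq_longTimeAvgSup, meanEnergy_eq_longTimeAvgSup]
  refine longTimeAvgSup_mono (fun t => integral_nonneg fun _ => sq_nonneg _)
    (fun t => integral_nonneg fun _ => sq_nonneg _) (fun T hT => hu.integrableOn_integral_norm_sq hT)
    (fun t ht => integral_norm_sq_planarPart_le (hinv t) ((hu (t + 1) (by linarith)).memLp t ⟨ht.le, by linarith⟩)) ?_
  exact isBoundedUnder_of_eventually_le (eventually_atTop.2 ⟨1, fun T hT => hu.timeMean_norm_sq_le hν hF hF0 hT⟩)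

/-- **THE GAP (one classical statement, not yet in the tree): 2½-D DESCENT WITH THE 2-D ENERGY EQUALITY.**  The planar part
`v = (u₁,u₂)(·,0)` of an `x₃`-invariant global Leray–Hopf solution `u` of NS_ν on `T³` driven by the `x₃`-invariant steady
force `(g,h)∘π` (smooth `g`, `h`; `g` solenoidal and mean zero) is a global Leray–Hopf solution of the 2-D system driven by `g`
from the planar part of the datum, and it obeys the energy EQUALITY — recorded in the only form used below, the long-time
budget `⟨g, v⟩ ≤ ⟨ν‖∇v‖²⟩` (the reverse of the Leray–Hopf inequality `DoeringFoias2002_dissipation_le_power`).  PAPER: the weak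
formulation descends by Fubini (test with `twoHalf Ψ 0`; tree: `TwoHalfWeakEuler` for the lift direction,
`Torus.integral_inner_twoHalf_planar`, `isWeaklyDivFree_of_twoHalf`, `memL2Sobolev_of_twoHalf`), `v ∈ L^∞L² ∩ L²H¹ ⊂ L⁴ₜ,ₓ`
(Ladyzhenskaya, tree: `ladyzhenskaya_torus2_holds`, `IsLerayHopfOn.lintegral_lintegral_enorm_pow_four_lt_top`), and
Leray–Hopf solutions in that class satisfy the energy EQUALITY — IN TREE in every dimension:
`Literature.Analysis.FluidPDE.lions_energy_equality_Ioc'` (`DuchonRobertLionsEnergyEqualityGeneral`; hypotheses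
`Torus.IsLerayHopfOn` + `MemLqLp 4 4`); with a uniform-in-time energy bound (momentum conservation + Poincaré on the
fluctuation; tree: `IsGlobalLerayHopf.exists_forall_integral_norm_sq_le` for the zero-mean lift) the boundary term
`(‖v(T)‖² - ‖v₀‖²)/2T → 0` and the second conjunct follows from the first.  So the IRREDUCIBLE content of the gap is the
first conjunct: the component-wise Leray–Hopf structure (energy inequalities for `v` ALONE), i.e. pure 2½-D bookkeeping plus
ONE of: the 2-D energy equality for energy-class weak solutions (not only Leray–Hopf ones), or the scaling trick "`(v, λw)` is
again a weak solution with force `(g, λh)`, so two energy identities split the budget".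
Sources: Bardos–Lopes Filho–Niu–Nussenzveig Lopes–Titi, SIAM J. Math. Anal. 45 (2013) §2 (2½-D reduction of Leray–Hopf
solutions); Majda–Bertozzi 2002 §2.3.1; Lions–Prodi 1959 / Foias–Manley–Rosa–Temam 2001 Ch. II Thm 7.3 and Sohr 2001
Thm V.1.4.1 (energy equality in 2-D).  (Stated with fully qualified names and no local notation so that it can be
relocated verbatim as a named fact.) [topic Analysis/FluidPDE] [cite: FoiasManleyRosaTemam2001, Ch. II Thm. 7.3] -/
def PlanarDescentEnergyEq : Prop :=
  ∀ (ν : ℝ) (g : UnitAddTorus (Fin 2) → EuclideanSpace ℝ (Fin 2)) (h : UnitAddTorus (Fin 2) → ℝ)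
    (u₀ : UnitAddTorus (Fin 3) → EuclideanSpace ℝ (Fin 3)) (u : ℝ → UnitAddTorus (Fin 3) → EuclideanSpace ℝ (Fin 3)),
    0 < ν →
    Literature.Analysis.FunctionSpaces.Torus.IsSmooth g → Literature.Analysis.FunctionSpaces.Torus.IsDivFree g →
    Literature.Analysis.FunctionSpaces.Torus.HasZeroMean g → Literature.Analysis.FunctionSpaces.Torus.IsSmooth h →
    Literature.Analysis.FluidPDE.Torus.IsGlobalLerayHopf ν
      (fun _ => Literature.Analysis.FunctionSpaces.Torus.twoHalf g h) u₀ u →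
    (∀ (s : UnitAddCircle) (x : UnitAddTorus (Fin 3)), u₀ (x + Pi.single (2 : Fin 3) s) = u₀ x) →
    (∀ (t : ℝ) (s : UnitAddCircle) (x : UnitAddTorus (Fin 3)), u t (x + Pi.single (2 : Fin 3) s) = u t x) →
    Literature.Analysis.FluidPDE.Torus.IsGlobalLerayHopf ν (fun _ => g)
        (fun y => Literature.Analysis.FunctionSpaces.Torus.planarProjE
          (u₀ (Literature.Analysis.FunctionSpaces.Torus.planarSect y)))
        (fun t y => Literature.Analysis.FunctionSpaces.Torus.planarProjE
          (u t (Literature.Analysis.FunctionSpaces.Torus.planarSect y))) ∧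
      Literature.Analysis.FluidPDE.meanPower g
          (fun t y => Literature.Analysis.FunctionSpaces.Torus.planarProjE
            (u t (Literature.Analysis.FunctionSpaces.Torus.planarSect y))) ≤
        Literature.Analysis.FluidPDE.meanDissipation ν
          (fun t y => Literature.Analysis.FunctionSpaces.Torus.planarProjE
            (u t (Literature.Analysis.FunctionSpaces.Torus.planarSect y)))

/-- `X` restricted to PLANAR forces `f = (g,0)∘π` and SMOOTH `x₃`-invariant data (the natural sub-case a constructor would try
first: the third component is an unforced passive scalar). -/
def TwohalfdThesisPlanarForceSmoothData : Prop :=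
  ∃ g : 𝕋² → E², IsSmooth g ∧ IsDivFree g ∧ HasZeroMean g ∧
    ∃ (ν : ℕ → ℝ) (u₀ : ℕ → 𝕋³ → E³) (u : ℕ → ℝ → 𝕋³ → E³),
      (∀ j, 0 < ν j) ∧ Tendsto ν atTop (𝓝 0) ∧
      (∀ j, IsSmooth (u₀ j)) ∧ (∀ j (s : UnitAddCircle) (x : 𝕋³), u₀ j (x + Pi.single (2 : Fin 3) s) = u₀ j x) ∧
      (∀ j, IsGlobalLerayHopf (ν j) (fun _ => twoHalf g 0) (u₀ j) (u j)) ∧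
      (∀ j (t : ℝ) (s : UnitAddCircle) (x : 𝕋³), u j t (x + Pi.single (2 : Fin 3) s) = u j t x) ∧
      (∃ E : ℝ, ∀ j, meanEnergy (u j) ≤ E) ∧
      ∃ ε : ℝ, 0 < ε ∧ ∀ j, ε ≤ meanDissipation (ν j) (u j)

/-- **PLANAR-FORCE NO-GO MODULO THE DESCENT GAP.**  Given `PlanarDescentEnergyEq`, `X` has no witness with a planar force and
smooth data: `ε ≤ ⟨ν_j‖∇u_j‖²⟩ ≤ ⟨f,u_j⟩` (Doering–Foias, tree) `= ⟨g,v_j⟩` (`meanPower_twoHalf_zero`) `≤ ⟨ν_j‖∇v_j‖²⟩` (the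
gap), while the 2-D Leray–Hopf family `v_j` has mean energy `≤ E` (`meanEnergy_planarPart_le`), smooth data, and
`U_j > 0` (else `⟨g,v_j⟩ ≤ ‖g‖U_j = 0 < ε`), so Alexakis–Doering (`Literature.Barriers.AnomalousDissipation.
no_twoDimensional_zerothLaw`, PROVED in tree; `g = ‖g‖₂·Φ` via `shapeOf`) gives `⟨ν_j‖∇v_j‖²⟩ → 0` — contradiction.  So the
third component MUST be sourced (`h ≠ 0`): all the anomaly of a witness is scalar dissipation paid for by `⟨h, u₃⟩`. [folklore] -/
theorem not_twohalfdThesisPlanarForceSmoothData_of_descent (H : PlanarDescentEnergyEq) :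
    ¬ TwohalfdThesisPlanarForceSmoothData := by
  rintro ⟨g, hgs, hgd, hgz, ν, u₀, u, hν, hν0, hu₀s, hu₀inv, hLH, huinv, ⟨E, hE⟩, ε, hε, hεj⟩
  have h0s : IsSmooth (fun _ : 𝕋² => (0 : ℝ)) := isSmooth_const _
  have hfs : IsSmooth (twoHalf g 0) := hgs.twoHalf h0s
  have hfz : HasZeroMean (twoHalf g 0) :=
    hasZeroMean_twoHalf hgs.integrable (integrable_const _) hgz (by simp [HasZeroMean])
  set v : ℕ → ℝ → 𝕋² → E² := fun j t => planarPart (u j t) with hv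
  have hdesc : ∀ j, IsGlobalLerayHopf (ν j) (fun _ => g) (planarPart (u₀ j)) (v j) ∧
      meanPower g (v j) ≤ meanDissipation (ν j) (v j) :=
    fun j => H (ν j) g 0 (u₀ j) (u j) (hν j) hgs hgd hgz h0s (hLH j) (hu₀inv j) (huinv j)
  -- ε ≤ ⟨g, v_j⟩ ≤ D₂(v_j)
  have hP : ∀ j, ε ≤ meanPower g (v j) := fun j => by
    have h1 := DoeringFoias2002_dissipation_le_power_holds (hν j) (hfs.memLp 2) hfz (u₀ j) (u j) (hLH j)
    have h2 : meanPower (twoHalf g 0) (u j) = meanPower g (v j) :=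
      meanPower_twoHalf_zero (hgs.memLp 2) (huinv j) fun t ht => ((hLH j) (t + 1) (by linarith)).memLp t ⟨ht.le, by linarith⟩
    exact (hεj j).trans (h1.trans h2.le)
  have hD : ∀ j, ε ≤ meanDissipation (ν j) (v j) := fun j => (hP j).trans (hdesc j).2
  -- power ceiling for the 2-D solution: ε ≤ ‖g‖₂ U_j
  have hPU : ∀ j, ε ≤ Real.sqrt (∫ y, ‖g y‖ ^ 2) * rmsVelocity longTimeAvgSup (v j) := fun j =>
    (hP j).trans (Torus.IsGlobalLerayHopf.meanPower_le (hν j) hgs hgz (hdesc j).1)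
  have hg0 : 0 < ∫ y, ‖g y‖ ^ 2 := by
    by_contra h0
    have h0' : ∫ y, ‖g y‖ ^ 2 = 0 := le_antisymm (not_lt.1 h0) (integral_nonneg fun _ => sq_nonneg _)
    have := hPU 0
    rw [h0', Real.sqrt_zero, zero_mul] at this
    exact absurd this (not_le.2 hε)
  have hUpos : ∀ j, 0 < rmsVelocity longTimeAvgSup (v j) := fun j => by
    by_contra hU
    have hU0 : rmsVelocity longTimeAvgSup (v j) = 0 := le_antisymm (not_lt.1 hU) (Real.sqrt_nonneg _)
    have := hPU j
    rw [hU0, mul_zero] at this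
    exact absurd this (not_le.2 hε)
  have hUle : ∀ j, rmsVelocity longTimeAvgSup (v j) ≤ Real.sqrt E := fun j => by
    rw [rmsVelocity_eq_sqrt_meanEnergy]
    exact Real.sqrt_le_sqrt ((meanEnergy_planarPart_le (hν j) hfs hfz (hLH j) (huinv j)).trans (hE j))
  -- Alexakis–Doering for the 2-D family `v_j` driven by `g = ‖g‖₂ · Φ(1 • x)`
  set Φ : ForcingShape (Fin 2) := shapeOf g hgs hgd hgz hg0 with hΦ
  have hforce : (fun _ : ℝ => Φ.force 1 (Real.sqrt (∫ y, ‖g y‖ ^ 2))) = fun _ => g :=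
    funext fun _ => shapeOf_force_one_norm
  have hLH2 : ∀ j, IsGlobalLerayHopf (ν j) (fun _ => Φ.force 1 (Real.sqrt (∫ y, ‖g y‖ ^ 2)))
      (planarPart (u₀ j)) (v j) := fun j => by
    rw [hforce]; exact (hdesc j).1
  have hsm : ∀ j, IsSmooth (planarPart (u₀ j)) := fun j => by
    have h := hu₀s j
    rw [eq_twoHalf_parts (hu₀inv j)] at h
    exact isSmooth_left_of_twoHalf h
  have hT := Literature.Barriers.AnomalousDissipation.no_twoDimensional_zerothLaw Φ one_pos
    (Real.sqrt (∫ y, ‖g y‖ ^ 2)) ν hν hν0 (fun j => planarPart (u₀ j)) v hsm hLH2 (Ubar := Real.sqrt E)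
    (fun j => ⟨hUpos j, hUle j⟩)
  obtain ⟨j, hj⟩ := (hT.eventually (gt_mem_nhds hε)).exists
  exact (not_lt.2 (hD j)) hj

end PlanarDescent

end Summit.AnomalousDissipation.AnomalousDissipation.Cruxes.TwohalfdThesis.Disproof

end
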